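import Mathlib
import HarnessLib
import Literature.Analysis.FluidPDE.LocalPressureOscillationTools

/-!
# Route `PoloidalWindowDoor`, crux `PoloidalWindowRigidity` (K2, stmt-NavierStokesRegularity-19708) — whole-class tool:
# THE QUADRATIC NEAR FIELD OF THE LOCAL PRESSURE IN `L²` (exponent-`2` copy of the tree's
# `Literature.Analysis.FluidPDE.exists_eLpNorm_nearField_le`, which is stated at exponent `3/2`)

Cell ns-regularity-ideate, seat ns-poloidal-K2-p3 gen 3 (stub-worker under the K2 lead; file landed
`--supports stmt-NavierStokesRegularity-19708` as a helper).  First brick of the `L²` form of (F1) for the class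
pressure, which takes the LARGE-SCALE ENERGY BOOTSTRAP (`…LargeScaleEnergyBootstrapLevels`, levels `α > 3/2` from the
`L^{3/2}` form) down to the scale-invariant floor `α > 1`.

The tree's Calderón–Zygmund bound `exists_eLpNorm_hessConv_le_of_memLp` holds for every `1 < p < ∞`; the near-field
lemma `exists_eLpNorm_nearField_le` instantiates it at `p = 3/2` only.  This file is the SAME proof at `p = 2`
(polarisation over the standard frame, nine convolutions, `eLpNorm_sum_le`):
* `exists_eLpNorm_nearField_le_two` — for a.e.-strongly measurable `w` vanishing off a ball with `|w|² ∈ L²`: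
  `‖N_δ[w]‖₂ ≤ C ‖|w|²‖₂` uniformly in `δ > 0`, `N_δ[w](c) = ∫ D²Φ_δ(c − y)(w y, w y) dy`.
[cite: KangMiuraTsai2020, §8 proof of Lemma 3.4 (Calderón–Zygmund estimate for p_loc, any q)]

WHAT THIS IS NOT: not a claim about Navier–Stokes regularity — harmonic analysis of one kernel (bears_on LADDER-NS N0
via crux K2 = stmt-19708; whole-class tool).
-/

noncomputable section

-- the summit and its single sub-problem share the name (CONVENTIONS §1), as in every Theorems file
set_option linter.dupNamespace false

namespace Summit.NavierStokesRegularity.NavierStokesRegularity.Theorems.PoloidalWindowDoorPoloidalWindowRigidityLargeScaleEnergyNearFieldTwo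

open MeasureTheory Set Filter Topology Function Metric
open scoped ENNReal NNReal RealInnerProductSpace Laplacian Convolution
open Literature.Analysis Literature.Analysis.FluidPDE

-- nested operator types
set_option maxSynthPendingDepth 3 in
/-- **The quadratic near field in `L²`, uniformly in the regularisation** (exponent-`2` twin of the tree's
`exists_eLpNorm_nearField_le`): there is a constant `C` such that for every `δ > 0` and every a.e.-strongly
measurable field `w` vanishing off a ball `B_R(x₀)` with `|w|² ∈ L²`, the near field
`N_δ[w](c) = ∫ D²Φ_δ(c - y)(w y, w y) dy` satisfies `‖N_δ[w]‖₂ ≤ C ‖|w|²‖₂`.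
[cite: KangMiuraTsai2020, §8 proof of Lemma 3.4 (Calderón–Zygmund estimate for p_loc)] -/
theorem exists_eLpNorm_nearField_le_two :
    ∃ C : ℝ≥0, ∀ δ : ℝ, 0 < δ → ∀ (x₀ : EuclideanSpace ℝ (Fin 3)) (R : ℝ)
      (w : EuclideanSpace ℝ (Fin 3) → EuclideanSpace ℝ (Fin 3)), AEStronglyMeasurable w volume →
      (∀ x, x ∉ ball x₀ R → w x = 0) → MemLp (fun x => ‖w x‖ ^ 2) 2 volume →
        eLpNorm (fun c => ∫ y, evalDiag (w y) (fderiv ℝ (fderiv ℝ (newtonReg δ)) (c - y))) 2 volume ≤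
          C * eLpNorm (fun x => ‖w x‖ ^ 2) 2 volume := by
  have h32_1 : (1 : ℝ≥0∞) < 2 := by norm_num
  have h32_top : (2 : ℝ≥0∞) < ⊤ := ENNReal.ofNat_lt_top
  obtain ⟨C, hC⟩ := exists_eLpNorm_hessConv_le_of_memLp h32_1 h32_top
  refine ⟨9 * (2⁻¹ * (3 * C)), fun δ hδ x₀ R w hw hwS hw2 => ?_⟩
  set b := EuclideanSpace.basisFun (Fin 3) ℝ with hb
  set Φ : EuclideanSpace ℝ (Fin 3) → ℝ := newtonReg δ with hΦ
  have hΦ2 : ContDiff ℝ 2 Φ := contDiff_newtonReg δ (n := 2)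
  -- pure second derivatives `k_a = ∂ₐ∂ₐΦ`
  set k : EuclideanSpace ℝ (Fin 3) → EuclideanSpace ℝ (Fin 3) → ℝ := fun a z =>
    fderiv ℝ (fun s => fderiv ℝ Φ s a) z a with hk
  have hkc : ∀ a, Continuous (k a) := fun a => FluidPDE.continuous_fderiv_fderiv_apply hΦ2 a a
  have hkb : ∀ a, ∃ M : ℝ, ∀ z, |k a z| ≤ M := fun a => (continuous_and_bounded_hessKernel hδ a).2
  -- a strongly measurable representative supported in the ball
  set w' : EuclideanSpace ℝ (Fin 3) → EuclideanSpace ℝ (Fin 3) := (ball x₀ R).indicator (hw.mk w)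
    with hw'
  have hw'm : StronglyMeasurable w' := hw.stronglyMeasurable_mk.indicator measurableSet_ball
  have hww' : w =ᵐ[volume] w' := by
    filter_upwards [hw.ae_eq_mk] with x hx
    by_cases hxS : x ∈ ball x₀ R
    · rw [hw', indicator_of_mem hxS, ← hx]
    · rw [hw', indicator_of_notMem hxS, hwS x hxS]
  have hw'S : ∀ x, x ∉ ball x₀ R → w' x = 0 := fun x hx => by rw [hw', indicator_of_notMem hx]
  have hw'supp : ∀ {f : EuclideanSpace ℝ (Fin 3) → ℝ}, (∀ x, w' x = 0 → f x = 0) → HasCompactSupport f :=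
    fun hf => HasCompactSupport.intro (isCompact_closedBall x₀ R) fun x hx =>
      hf x (hw'S x fun h => hx (ball_subset_closedBall h))
  have hw'2 : MemLp (fun x => ‖w' x‖ ^ 2) 2 volume :=
    hw2.ae_eq (hww'.mono fun x hx => by simp only [hx])
  have hnorm : eLpNorm (fun x => ‖w' x‖ ^ 2) 2 volume = eLpNorm (fun x => ‖w x‖ ^ 2) 2 volume :=
    eLpNorm_congr_ae (hww'.mono fun x hx => by simp only [hx])
  -- replace `w` by `w'` in the near field
  have hNeq : (fun c => ∫ y, evalDiag (w y) (fderiv ℝ (fderiv ℝ Φ) (c - y))) =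
      fun c => ∫ y, evalDiag (w' y) (fderiv ℝ (fderiv ℝ Φ) (c - y)) := by
    funext c
    exact integral_congr_ae (hww'.mono fun y hy => by
      show evalDiag (w y) _ = evalDiag (w' y) _
      rw [hy])
  rw [hNeq, ← hnorm]
  -- the coefficient densities `gᵢⱼ = w'ᵢ w'ⱼ`
  set g : Fin 3 → Fin 3 → EuclideanSpace ℝ (Fin 3) → ℝ := fun i j y => ⟪w' y, b i⟫ * ⟪w' y, b j⟫ with hg
  have hgm : ∀ i j, Measurable (g i j) := fun i j =>
    (hw'm.measurable.inner measurable_const).mul (hw'm.measurable.inner measurable_const)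
  have hg_le : ∀ i j y, ‖g i j y‖ ≤ ‖w' y‖ ^ 2 := by
    intro i j y
    rw [hg]
    dsimp only
    rw [norm_mul, Real.norm_eq_abs, Real.norm_eq_abs]
    have h1 : |⟪w' y, b i⟫| ≤ ‖w' y‖ := by
      have := abs_real_inner_le_norm (w' y) (b i)
      rwa [b.norm_eq_one, mul_one] at this
    have h2 : |⟪w' y, b j⟫| ≤ ‖w' y‖ := by
      have := abs_real_inner_le_norm (w' y) (b j)
      rwa [b.norm_eq_one, mul_one] at this
    calc |⟪w' y, b i⟫| * |⟪w' y, b j⟫| ≤ ‖w' y‖ * ‖w' y‖ :=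
          mul_le_mul h1 h2 (abs_nonneg _) (norm_nonneg _)
      _ = ‖w' y‖ ^ 2 := by ring
  have hg_mem : ∀ i j, MemLp (g i j) 2 volume := fun i j =>
    hw'2.of_le (hgm i j).aestronglyMeasurable (Eventually.of_forall fun y => by
      rw [Real.norm_of_nonneg (sq_nonneg _)]; exact hg_le i j y)
  have hg_supp : ∀ i j, HasCompactSupport (g i j) := fun i j =>
    hw'supp fun x hx => by simp [hg, hx]
  have hg_norm : ∀ i j, eLpNorm (g i j) 2 volume ≤ eLpNorm (fun x => ‖w' x‖ ^ 2) 2 volume :=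
    fun i j => eLpNorm_mono fun y => by
      rw [Real.norm_of_nonneg (sq_nonneg ‖w' y‖)]; exact hg_le i j y
  have hgi : ∀ i j, Integrable (g i j) volume := by
    intro i j
    have h1 : MemLp (g i j) 2 (volume.restrict (closedBall x₀ R)) := (hg_mem i j).restrict _
    haveI : IsFiniteMeasure ((volume : Measure (EuclideanSpace ℝ (Fin 3))).restrict (closedBall x₀ R)) :=
      ⟨by rw [Measure.restrict_apply_univ]; exact measure_closedBall_lt_top⟩
    have h2 : IntegrableOn (g i j) (closedBall x₀ R) volume := h1.integrable h32_1.le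
    exact h2.integrable_of_forall_notMem_eq_zero fun x hx => by
      have : w' x = 0 := hw'S x fun h => hx (ball_subset_closedBall h)
      simp [hg, this]
  -- the convolutions `T_a gᵢⱼ`
  set T : EuclideanSpace ℝ (Fin 3) → Fin 3 → Fin 3 → EuclideanSpace ℝ (Fin 3) → ℝ :=
    fun a i j c => ∫ y, g i j y * k a (c - y) with hT
  have hTm : ∀ a i j, AEStronglyMeasurable (T a i j) volume := fun a i j =>
    aestronglyMeasurable_conv_kernel (hgm i j) (hkc a)
  have hTi : ∀ a i j c, Integrable (fun y => g i j y * k a (c - y)) volume := by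
    intro a i j c
    obtain ⟨M, hM⟩ := hkb a
    refine (hgi i j).mul_bdd (c := M) ((hkc a).comp (continuous_const.sub continuous_id)).aestronglyMeasurable
      (ae_of_all _ fun y => ?_)
    rw [Real.norm_eq_abs]; exact hM _
  have hTbound : ∀ a, ‖a‖ ≤ 2 → ∀ i j, eLpNorm (T a i j) 2 volume ≤
      C * eLpNorm (fun x => ‖w' x‖ ^ 2) 2 volume := fun a ha i j =>
    (hC δ hδ a ha (g i j) (hgm i j) (hg_supp i j) (hg_mem i j)).trans (mul_le_mul' le_rfl (hg_norm i j))
  -- polarisation: the near field as a sum of convolutions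
  set F : Fin 3 → Fin 3 → EuclideanSpace ℝ (Fin 3) → ℝ := fun i j =>
    (2⁻¹ : ℝ) • (T (b j + b i) i j - T (b j) i j - T (b i) i j) with hF
  have hkey : (fun c => ∫ y, evalDiag (w' y) (fderiv ℝ (fderiv ℝ Φ) (c - y))) = ∑ i, ∑ j, F i j := by
    funext c
    rw [Finset.sum_apply]
    simp_rw [Finset.sum_apply]
    have hd : ∀ z, DifferentiableAt ℝ (fderiv ℝ Φ) z := fun z =>
      ((hΦ2.fderiv_right (m := 1) le_rfl).differentiable one_ne_zero) z
    have hpt : ∀ y, evalDiag (w' y) (fderiv ℝ (fderiv ℝ Φ) (c - y)) =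
        ∑ i, ∑ j, g i j y * (2⁻¹ * (k (b j + b i) (c - y) - k (b j) (c - y) - k (b i) (c - y))) := by
      intro y
      rw [evalDiag_apply, clm_apply_apply_eq_sum_basisFun]
      refine Finset.sum_congr rfl fun i _ => Finset.sum_congr rfl fun j _ => ?_
      rw [hg, hk]
      dsimp only
      rw [← FluidPDE.fderiv_apply_const_apply (hd (c - y)) (b j) (b i),
        fderiv_fderiv_apply_polarisation hΦ2 (c - y) (b j) (b i)]
    simp_rw [hpt]
    have hterm : ∀ i j, Integrable (fun y => g i j y *
        (2⁻¹ * (k (b j + b i) (c - y) - k (b j) (c - y) - k (b i) (c - y)))) volume := by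
      intro i j
      have h := (((hTi (b j + b i) i j c).sub (hTi (b j) i j c)).sub (hTi (b i) i j c)).const_mul (2⁻¹ : ℝ)
      refine h.congr (Eventually.of_forall fun y => ?_)
      simp only [Pi.sub_apply]
      ring
    rw [integral_finsetSum _ (fun i _ => integrable_finsetSum _ fun j _ => hterm i j)]
    refine Finset.sum_congr rfl fun i _ => ?_
    rw [integral_finsetSum _ (fun j _ => hterm i j)]
    refine Finset.sum_congr rfl fun j _ => ?_
    rw [hF]
    simp only [Pi.smul_apply, Pi.sub_apply, smul_eq_mul, hT]
    have e1 : ∀ y, g i j y * (2⁻¹ * (k (b j + b i) (c - y) - k (b j) (c - y) - k (b i) (c - y))) =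
        2⁻¹ * (g i j y * k (b j + b i) (c - y) - g i j y * k (b j) (c - y) -
          g i j y * k (b i) (c - y)) := fun y => by ring
    simp_rw [e1]
    rw [integral_const_mul,
      integral_sub (f := fun y => g i j y * k (b j + b i) (c - y) - g i j y * k (b j) (c - y))
        (g := fun y => g i j y * k (b i) (c - y)) ((hTi (b j + b i) i j c).sub (hTi (b j) i j c))
        (hTi (b i) i j c),
      integral_sub (hTi (b j + b i) i j c) (hTi (b j) i j c)]
  rw [show (fderiv ℝ (fderiv ℝ Φ)) = fderiv ℝ (fderiv ℝ (newtonReg δ)) from rfl] at hkey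
  rw [hkey]
  -- norms of the summands
  have hFm : ∀ i j, AEStronglyMeasurable (F i j) volume := fun i j =>
    (((hTm _ i j).sub (hTm _ i j)).sub (hTm _ i j)).const_smul _
  have hb1 : ∀ i, ‖b i‖ ≤ 2 := fun i => by rw [b.norm_eq_one]; norm_num
  have hb2 : ∀ i j, ‖b j + b i‖ ≤ 2 := fun i j =>
    (norm_add_le _ _).trans (by rw [b.norm_eq_one, b.norm_eq_one]; norm_num)
  have hFbound : ∀ i j, eLpNorm (F i j) 2 volume ≤
      (2⁻¹ * (3 * C) : ℝ≥0) * eLpNorm (fun x => ‖w' x‖ ^ 2) 2 volume := by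
    intro i j
    rw [hF, eLpNorm_const_smul]
    have e2 : ‖(2⁻¹ : ℝ)‖ₑ = ((2⁻¹ : ℝ≥0) : ℝ≥0∞) := by
      rw [Real.enorm_eq_ofReal (by norm_num), ENNReal.ofReal_inv_of_pos (by norm_num), ENNReal.ofReal_ofNat]
      norm_num
    rw [e2, ENNReal.coe_mul, mul_assoc]
    gcongr
    calc eLpNorm (T (b j + b i) i j - T (b j) i j - T (b i) i j) 2 volume
        ≤ eLpNorm (T (b j + b i) i j - T (b j) i j) 2 volume + eLpNorm (T (b i) i j) 2 volume :=
          eLpNorm_sub_le ((hTm _ i j).sub (hTm _ i j)) (hTm _ i j) h32_1.le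
      _ ≤ (eLpNorm (T (b j + b i) i j) 2 volume + eLpNorm (T (b j) i j) 2 volume) +
            eLpNorm (T (b i) i j) 2 volume := by
          gcongr
          exact eLpNorm_sub_le (hTm _ i j) (hTm _ i j) h32_1.le
      _ ≤ (C * eLpNorm (fun x => ‖w' x‖ ^ 2) 2 volume + C * eLpNorm (fun x => ‖w' x‖ ^ 2) 2 volume) +
            C * eLpNorm (fun x => ‖w' x‖ ^ 2) 2 volume :=
          add_le_add (add_le_add (hTbound _ (hb2 i j) i j) (hTbound _ (hb1 j) i j)) (hTbound _ (hb1 i) i j)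
      _ = ((3 * C : ℝ≥0) : ℝ≥0∞) * eLpNorm (fun x => ‖w' x‖ ^ 2) 2 volume := by
          push_cast; ring
  calc eLpNorm (∑ i, ∑ j, F i j) 2 volume ≤ ∑ i, eLpNorm (∑ j, F i j) 2 volume :=
        eLpNorm_sum_le (fun i _ => Finset.aestronglyMeasurable_sum _ fun j _ => hFm i j) h32_1.le
    _ ≤ ∑ i, ∑ j, eLpNorm (F i j) 2 volume :=
        Finset.sum_le_sum fun i _ => eLpNorm_sum_le (fun j _ => hFm i j) h32_1.le
    _ ≤ ∑ _i : Fin 3, ∑ _j : Fin 3, ((2⁻¹ * (3 * C) : ℝ≥0) : ℝ≥0∞) * eLpNorm (fun x => ‖w' x‖ ^ 2) 2 volume :=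
        Finset.sum_le_sum fun i _ => Finset.sum_le_sum fun j _ => hFbound i j
    _ = ((9 * (2⁻¹ * (3 * C)) : ℝ≥0) : ℝ≥0∞) * eLpNorm (fun x => ‖w' x‖ ^ 2) 2 volume := by
        simp only [Finset.sum_const, Finset.card_univ, Fintype.card_fin, nsmul_eq_mul]
        push_cast
        ring

end Summit.NavierStokesRegularity.NavierStokesRegularity.Theorems.PoloidalWindowDoorPoloidalWindowRigidityLargeScaleEnergyNearFieldTwo

end
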